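/-
Copyright (c) 2026 the pub-hodgecm-mathlib formalisation cell (harness21).  Prover seat hodgecm-mathlib-K2E1-p15 (g3), Track B ∕ K2-LIT, h413 = `stmt-HodgeConjecture-24833`,
R90-TF section S8 «ContSpec-n½», #4′ road, MODEL-FAMILY brick ED. 2 item «BLK-ISO» (census `R90/S8/CENSUS-ModelFamily.K2E1-p15-g3.md`, S8-R49 «=»): THE `(K′, ω)`-BLOCK IS
`(K′, ω)`-ISOTYPIC — `Sc(K′, ω, χ) ≤ ⨅_{k ∈ K′} ker(R(k) − ω(k))` under the height-invariance letter `hHK′`, i.e. the `hLnP` input «`Sc ≤ Iso(K′, ω)`».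
-/
import Summits.HodgeConjecture.HodgeConjecture.Theorems.R90S8ResHBlockDataU2Defs        -- ★ p862464 (this seat): `resHBlock` ∕ `resHAtom` ∕ `resHLine` + read-backs
import Summits.HodgeConjecture.HodgeConjecture.Theorems.K2E1ChiSectionHeckeStableCMTwo    -- ★ B1 (K2E1-p11): `eisensteinSeriesU_radialSection_quotientSubgroup_mul` (left `G(F)`-invariance of `θ_{f,φ}`)
import Literature.NumberTheory.Automorphic.AutomorphicRepsGLCuspidalUnitary               -- ★ `AdelicGroupData.quotFun_rightTranslation`, `quotFun_smul`
import HarnessLib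

/-!
# S8 #4′ road — `R90S8ResHBlockIsotypicU2`: the block `Sc(K′, ω, χ)` lies in the `(K′, ω)`-isotypic subspace `Iso(K′, ω) = ⨅_{k ∈ K′} ker(R(k) − ω(k)·1)` (BLK-ISO)

Track B ∕ K2-LIT, crux h413 = `stmt-HodgeConjecture-24833`, route of record `HCCMUnconditional`; cell `hodgecm-mathlib`, R90-TF programme, section S8 «ContSpec-n½», socket #4′
`sock_S8_resH_spannedByCharLines` (B ED. 4 :256).  THEOREMS ONLY (no `def`, no `instance`, no `notation`, no named-fact hypothesis, no `sorry`; default heartbeats); lane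
`--supports stmt-HodgeConjecture-24833 --as helper` (count-neutral).  CLOSES NO SOCKET.  WHY: the (N_blk) payer ★ p862453 needs `hLnP : ∀ v ∈ Ln, P v = v`, i.e. `Ln ≤ V_P`; ★
`R90S8ResHBlockModelFamilyU2.hLnP_of_resHBlock_le` reduces it to `Sc ≤ V_P`, and `V_P = eqLocus P id` is the `(K′, ω)`-isotypic subspace by ★ `cm_blockProjector_eq_self_iff` — so what is
needed is `Sc ≤ Iso(K′, ω)`, proved here under the print's height-invariance letter `hHK′ : ∀ g k, k ∈ K′ → H(gk) = H(g)` (★ for the Λ′ family by `archLevel_witness_cm` ∕ ★ H6 p862475).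

THE MATHEMATICS ([MoeglinWaldspurger1995, II.1.1, II.1.5]; [BorelJacquet1979, §4.6]; the `ω = 1` case is ★ `K2E1ResidualBlockPackageOffDualHeckeCMTwo.rightRegular_apply_brick_eq_self`, whose proof
is followed line by line).  For `φ ∈ V(χ, K′, ω)` (`φ(gk) = ω(k)φ(g)`, `k ∈ K′`) and `k ∈ K′` with `H(gk) = H(g)`: the profile `Ψ = (f∘H)·φ` satisfies `Ψ(gk) = ω(k)Ψ(g)`, hence so does its
Eisenstein series `θ = E(Ψ)` (a sum over `B(F)∖G(F)` acting on the LEFT), i.e. `r(k)θ = ω(k)·θ`; `θ` is left-`G(F)`-invariant (★ B1), so on the quotient `quotFun (r(k)θ) = quotFun θ (k⁻¹ • ·)`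
(★ `quotFun_rightTranslation`), and `(R(k)[θ])(x) = [θ](k⁻¹ • x)` a.e. (★ `rightRegular_apply_coeFn`): `R(k)[θ] = ω(k)·[θ]` in `L²`.  The isotypic subspace is closed, so the CLOSED span
`Sc` of the `[θ]` lies in it.
* §1 **`rightRegular_apply_toLp_brick_eq_smul`** — `R(k)[θ_{f,φ}] = ω(k) • [θ_{f,φ}]` for `k ∈ K′`, `φ ∈ V(χ, K′, ω)`, under `hHK′`.
* §2 `isClosed_iInf_eigenspace_rightRegular`, **`resHBlock_le_iInf_eigenspace`** (BLK-ISO), `resHLine_le_iInf_eigenspace`, `resHAtom_le_iInf_eigenspace` — the `hLnP` inputs «`Ln ≤ Iso`»,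
  «`At ≤ Iso`» for ANY block-model map `U`.
HONEST LABEL: HC_CM is proved only modulo the 7 printed citations (2 remaining named inputs: hLiu418 = `stmt-HodgeConjecture-24832`, h413 = `stmt-HodgeConjecture-24833`) until
rung 0 closes; REL ≠ ★ ≠ BUILT; this file asserts no named fact, is conditional by construction on its visible binder `hHK′`, and closes no socket; count-neutral.

## References
* [MoeglinWaldspurger1995] C. Mœglin, J.-L. Waldspurger, *Spectral Decomposition and Eisenstein Series* (1995), II.1.1, II.1.5.
* [BorelJacquet1979] A. Borel, H. Jacquet, *Automorphic forms and automorphic representations*, Corvallis PSPM 33.1 (1979), §4.6.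
-/

set_option autoImplicit false
set_option linter.dupNamespace false  -- the mandated namespace `…HodgeConjecture.HodgeConjecture.R90.S8` (LEAD #1 L1) repeats the summit's segment

noncomputable section

open MeasureTheory Measure Set Filter Topology NumberField
open Literature.NumberTheory Literature.NumberTheory.Automorphic Literature.NumberTheory.Automorphic.UnitaryGroup Literature.NumberTheory.GaloisRepresentations AdelicGroupData
open Summit.HodgeConjecture.HodgeConjecture.Cruxes.H413.K2E1BorelEisensteinU
open Summit.HodgeConjecture.HodgeConjecture.Cruxes.H413.K2E1CharacterEisensteinU2Defs
open Summit.HodgeConjecture.HodgeConjecture.Cruxes.H413.K2E1ChiSectionSpaceU2Defs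
open Summit.HodgeConjecture.HodgeConjecture.Cruxes.H413.K2E1ChiSectionHeckeStableCMTwo (eisensteinSeriesU_radialSection_quotientSubgroup_mul)
open scoped ENNReal NNReal InnerProductSpace

namespace Summit.HodgeConjecture.HodgeConjecture.R90.S8

variable (L : Type) [Field L] [NumberField L] [IsCMField L]
  [MeasurableSpace (quasiSplit (↥(maximalRealSubfield L)) L (IsCMField.complexConj L) 2).Adelic] [BorelSpace (quasiSplit (↥(maximalRealSubfield L)) L (IsCMField.complexConj L) 2).Adelic]
  (μ : Measure (quasiSplit (↥(maximalRealSubfield L)) L (IsCMField.complexConj L) 2).automorphicQuotient) [(quasiSplit (↥(maximalRealSubfield L)) L (IsCMField.complexConj L) 2).IsAutomorphicMeasure μ]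

/-! ## §1 Each wave packet `[θ_{f,φ}]` is a `(K′, ω)`-eigenvector -/

/-- **`R(k)[θ_{f,φ}] = ω(k) • [θ_{f,φ}]`** for `k ∈ K′` and `φ ∈ V(χ, K′, ω)`, when `K′` preserves the Borel height (`hHK′`): the profile `(f∘H)·φ` and hence its Eisenstein series transform by
`ω(k)` under right translation by `k`; ★ `quotFun_rightTranslation` + ★ `rightRegular_apply_coeFn` carry this to `L²` (the `ω = 1` case is ★ `rightRegular_apply_brick_eq_self`).
[cite: MoeglinWaldspurger1995, II.1.1, II.1.5] [cite: BorelJacquet1979, §4.6] -/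
theorem rightRegular_apply_toLp_brick_eq_smul (K' : Subgroup (quasiSplit (↥(maximalRealSubfield L)) L (IsCMField.complexConj L) 2).Adelic) (ω : ↥K' →* ℂ)
    (hHK' : ∀ (g k : (quasiSplit (↥(maximalRealSubfield L)) L (IsCMField.complexConj L) 2).Adelic), k ∈ K' → borelHeight (g * k) = borelHeight g)
    {χ : HeckeCharacter L} {f : ℝ → ℂ} {φ : (quasiSplit (↥(maximalRealSubfield L)) L (IsCMField.complexConj L) 2).Adelic → ℂ} (hφ : φ ∈ chiSectionSpace χ K' (ω : ↥K' → ℂ))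
    (hv : MemLp ((quasiSplit (↥(maximalRealSubfield L)) L (IsCMField.complexConj L) 2).quotFun (eisensteinSeriesU (fun g : (quasiSplit (↥(maximalRealSubfield L)) L (IsCMField.complexConj L) 2).Adelic => f (borelHeight g : ℝ) * φ g))) 2 μ)
    {k : (quasiSplit (↥(maximalRealSubfield L)) L (IsCMField.complexConj L) 2).Adelic} (hk : k ∈ K') :
    ((quasiSplit (↥(maximalRealSubfield L)) L (IsCMField.complexConj L) 2).rightRegular μ) k (hv.toLp _) = ω ⟨k, hk⟩ • hv.toLp _ := by
  -- the profile and its Eisenstein series transform by `ω(k)` under `g ↦ g k`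
  have hφk : ∀ g : (quasiSplit (↥(maximalRealSubfield L)) L (IsCMField.complexConj L) 2).Adelic, φ (g * k) = ω ⟨k, hk⟩ * φ g := fun g =>
    ((mem_chiSectionSpace_iff φ).1 hφ).2 g ⟨k, hk⟩
  have hF : ∀ g : (quasiSplit (↥(maximalRealSubfield L)) L (IsCMField.complexConj L) 2).Adelic,
      f (borelHeight (g * k) : ℝ) * φ (g * k) = ω ⟨k, hk⟩ * (f (borelHeight g : ℝ) * φ g) := fun g => by
    rw [hHK' g k hk, hφk g]; ring
  have hE : ∀ g : (quasiSplit (↥(maximalRealSubfield L)) L (IsCMField.complexConj L) 2).Adelic,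
      eisensteinSeriesU (fun g : (quasiSplit (↥(maximalRealSubfield L)) L (IsCMField.complexConj L) 2).Adelic => f (borelHeight g : ℝ) * φ g) (g * k) =
        ω ⟨k, hk⟩ * eisensteinSeriesU (fun g : (quasiSplit (↥(maximalRealSubfield L)) L (IsCMField.complexConj L) 2).Adelic => f (borelHeight g : ℝ) * φ g) g := fun g => by
    rw [eisensteinSeriesU_def, eisensteinSeriesU_def, ← tsum_mul_left]
    exact tsum_congr fun q => by rw [← mul_assoc]; exact hF _
  -- right translation on `G(𝔸)` = the left action on the quotient
  have hinv := eisensteinSeriesU_radialSection_quotientSubgroup_mul L ((mem_chiSectionSpace_iff φ).1 hφ).1 f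
  have hrt : rightTranslation (quasiSplit (↥(maximalRealSubfield L)) L (IsCMField.complexConj L) 2) k (eisensteinSeriesU (fun g : (quasiSplit (↥(maximalRealSubfield L)) L (IsCMField.complexConj L) 2).Adelic => f (borelHeight g : ℝ) * φ g)) =
      ω ⟨k, hk⟩ • eisensteinSeriesU (fun g : (quasiSplit (↥(maximalRealSubfield L)) L (IsCMField.complexConj L) 2).Adelic => f (borelHeight g : ℝ) * φ g) :=
    funext fun g => by rw [rightTranslation_apply, hE, Pi.smul_apply, smul_eq_mul]
  have h3 := AdelicGroupData.quotFun_rightTranslation hinv k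
  rw [hrt, AdelicGroupData.quotFun_smul] at h3
  -- compare a.e. on the quotient
  apply Lp.ext
  have h1 := (quasiSplit (↥(maximalRealSubfield L)) L (IsCMField.complexConj L) 2).rightRegular_apply_coeFn μ k (hv.toLp _)
  have h2 := (measurePreserving_smul k⁻¹ μ).quasiMeasurePreserving.ae_eq_comp hv.coeFn_toLp
  refine h1.trans (h2.trans ?_)
  refine Filter.EventuallyEq.trans (Filter.Eventually.of_forall fun x => (congrFun h3 x).symm) ?_
  refine Filter.EventuallyEq.trans ?_ (Lp.coeFn_smul _ _).symm
  exact hv.coeFn_toLp.symm.const_smul (ω ⟨k, hk⟩)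

/-! ## §2 The block, its atoms and its lines are `(K′, ω)`-isotypic (BLK-ISO) -/

omit [MeasurableSpace (quasiSplit (↥(maximalRealSubfield L)) L (IsCMField.complexConj L) 2).Adelic] [BorelSpace (quasiSplit (↥(maximalRealSubfield L)) L (IsCMField.complexConj L) 2).Adelic] in
/-- The `(K′, ω)`-isotypic subspace `⨅_{k ∈ K′} ker(R(k) − ω(k))` is closed (an intersection of equalisers of continuous maps). [folklore] -/
theorem isClosed_iInf_eigenspace_rightRegular (K' : Subgroup (quasiSplit (↥(maximalRealSubfield L)) L (IsCMField.complexConj L) 2).Adelic) (ω : ↥K' →* ℂ) :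
    IsClosed ((⨅ k : ↥K', Module.End.eigenspace ((((quasiSplit (↥(maximalRealSubfield L)) L (IsCMField.complexConj L) 2).rightRegular μ) (K'.subtype k) :
        (quasiSplit (↥(maximalRealSubfield L)) L (IsCMField.complexConj L) 2).L2 μ →L[ℂ] (quasiSplit (↥(maximalRealSubfield L)) L (IsCMField.complexConj L) 2).L2 μ) :
        (quasiSplit (↥(maximalRealSubfield L)) L (IsCMField.complexConj L) 2).L2 μ →ₗ[ℂ] (quasiSplit (↥(maximalRealSubfield L)) L (IsCMField.complexConj L) 2).L2 μ) (ω k) :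
        Submodule ℂ ((quasiSplit (↥(maximalRealSubfield L)) L (IsCMField.complexConj L) 2).L2 μ)) : Set ((quasiSplit (↥(maximalRealSubfield L)) L (IsCMField.complexConj L) 2).L2 μ)) := by
  rw [Submodule.coe_iInf]
  refine isClosed_iInter fun k => ?_
  have hset : ((Module.End.eigenspace ((((quasiSplit (↥(maximalRealSubfield L)) L (IsCMField.complexConj L) 2).rightRegular μ) (K'.subtype k) :
        (quasiSplit (↥(maximalRealSubfield L)) L (IsCMField.complexConj L) 2).L2 μ →L[ℂ] (quasiSplit (↥(maximalRealSubfield L)) L (IsCMField.complexConj L) 2).L2 μ) :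
        (quasiSplit (↥(maximalRealSubfield L)) L (IsCMField.complexConj L) 2).L2 μ →ₗ[ℂ] (quasiSplit (↥(maximalRealSubfield L)) L (IsCMField.complexConj L) 2).L2 μ) (ω k) :
        Submodule ℂ ((quasiSplit (↥(maximalRealSubfield L)) L (IsCMField.complexConj L) 2).L2 μ)) : Set ((quasiSplit (↥(maximalRealSubfield L)) L (IsCMField.complexConj L) 2).L2 μ)) =
      {x | ((quasiSplit (↥(maximalRealSubfield L)) L (IsCMField.complexConj L) 2).rightRegular μ) (K'.subtype k) x = ω k • x} :=
    Set.ext fun x => Module.End.mem_eigenspace_iff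
  rw [hset]
  exact isClosed_eq (((quasiSplit (↥(maximalRealSubfield L)) L (IsCMField.complexConj L) 2).rightRegular μ) (K'.subtype k)).continuous (continuous_const_smul (ω k))

/-- **BLK-ISO — THE BLOCK IS `(K′, ω)`-ISOTYPIC**: under the height-invariance letter `hHK′`, `Sc(K′, ω, χ) ≤ ⨅_{k ∈ K′} ker(R(k) − ω(k))` — the generating wave packets are eigenvectors (§1) and the
isotypic subspace is closed. [cite: MoeglinWaldspurger1995, II.1.1, II.1.5] [cite: BorelJacquet1979, §4.6] -/
theorem resHBlock_le_iInf_eigenspace (K' : Subgroup (quasiSplit (↥(maximalRealSubfield L)) L (IsCMField.complexConj L) 2).Adelic) (ω : ↥K' →* ℂ)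
    (hHK' : ∀ (g k : (quasiSplit (↥(maximalRealSubfield L)) L (IsCMField.complexConj L) 2).Adelic), k ∈ K' → borelHeight (g * k) = borelHeight g) (χ : HeckeCharacter L) :
    resHBlock L μ K' ω χ ≤ ⨅ k : ↥K', Module.End.eigenspace ((((quasiSplit (↥(maximalRealSubfield L)) L (IsCMField.complexConj L) 2).rightRegular μ) (K'.subtype k) :
        (quasiSplit (↥(maximalRealSubfield L)) L (IsCMField.complexConj L) 2).L2 μ →L[ℂ] (quasiSplit (↥(maximalRealSubfield L)) L (IsCMField.complexConj L) 2).L2 μ) :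
        (quasiSplit (↥(maximalRealSubfield L)) L (IsCMField.complexConj L) 2).L2 μ →ₗ[ℂ] (quasiSplit (↥(maximalRealSubfield L)) L (IsCMField.complexConj L) 2).L2 μ) (ω k) := by
  rw [resHBlock_def]
  refine Submodule.topologicalClosure_minimal _ (Submodule.span_le.2 ?_) (isClosed_iInf_eigenspace_rightRegular L μ K' ω)
  rintro v ⟨f, hf, hfs, hf0, φ, hφ, hφc, hv, rfl⟩
  refine (Submodule.mem_iInf _).2 fun k => Module.End.mem_eigenspace_iff.2 ?_
  have h := rightRegular_apply_toLp_brick_eq_smul L μ K' ω hHK' hφ hv k.2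
  exact h

/-- `Ln ≤ Iso(K′, ω)` — the `hLnP` input of the (N_blk) payer, for ANY block-model map `U` (BLK-ISO ∘ ★ `resHLine_le_resHBlock`). [cite: MoeglinWaldspurger1995, II.1.5] -/
theorem resHLine_le_iInf_eigenspace {A Λ : Type*} [AddCommGroup A] [Module ℂ A] [AddCommGroup Λ] [Module ℂ Λ]
    (U : (quasiSplit (↥(maximalRealSubfield L)) L (IsCMField.complexConj L) 2).L2 μ →ₗ[ℂ] A × Λ)
    (K' : Subgroup (quasiSplit (↥(maximalRealSubfield L)) L (IsCMField.complexConj L) 2).Adelic) (ω : ↥K' →* ℂ)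
    (hHK' : ∀ (g k : (quasiSplit (↥(maximalRealSubfield L)) L (IsCMField.complexConj L) 2).Adelic), k ∈ K' → borelHeight (g * k) = borelHeight g) (χ : HeckeCharacter L) :
    resHLine L μ U K' ω χ ≤ ⨅ k : ↥K', Module.End.eigenspace ((((quasiSplit (↥(maximalRealSubfield L)) L (IsCMField.complexConj L) 2).rightRegular μ) (K'.subtype k) :
        (quasiSplit (↥(maximalRealSubfield L)) L (IsCMField.complexConj L) 2).L2 μ →L[ℂ] (quasiSplit (↥(maximalRealSubfield L)) L (IsCMField.complexConj L) 2).L2 μ) :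
        (quasiSplit (↥(maximalRealSubfield L)) L (IsCMField.complexConj L) 2).L2 μ →ₗ[ℂ] (quasiSplit (↥(maximalRealSubfield L)) L (IsCMField.complexConj L) 2).L2 μ) (ω k) :=
  (resHLine_le_resHBlock L μ U K' ω χ).trans (resHBlock_le_iInf_eigenspace L μ K' ω hHK' χ)

/-- `At ≤ Iso(K′, ω)` (BLK-ISO ∘ ★ `resHAtom_le_resHBlock`). [cite: MoeglinWaldspurger1995, II.1.5] -/
theorem resHAtom_le_iInf_eigenspace {A Λ : Type*} [AddCommGroup A] [Module ℂ A] [AddCommGroup Λ] [Module ℂ Λ]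
    (U : (quasiSplit (↥(maximalRealSubfield L)) L (IsCMField.complexConj L) 2).L2 μ →ₗ[ℂ] A × Λ)
    (K' : Subgroup (quasiSplit (↥(maximalRealSubfield L)) L (IsCMField.complexConj L) 2).Adelic) (ω : ↥K' →* ℂ)
    (hHK' : ∀ (g k : (quasiSplit (↥(maximalRealSubfield L)) L (IsCMField.complexConj L) 2).Adelic), k ∈ K' → borelHeight (g * k) = borelHeight g) (χ : HeckeCharacter L) :
    resHAtom L μ U K' ω χ ≤ ⨅ k : ↥K', Module.End.eigenspace ((((quasiSplit (↥(maximalRealSubfield L)) L (IsCMField.complexConj L) 2).rightRegular μ) (K'.subtype k) :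
        (quasiSplit (↥(maximalRealSubfield L)) L (IsCMField.complexConj L) 2).L2 μ →L[ℂ] (quasiSplit (↥(maximalRealSubfield L)) L (IsCMField.complexConj L) 2).L2 μ) :
        (quasiSplit (↥(maximalRealSubfield L)) L (IsCMField.complexConj L) 2).L2 μ →ₗ[ℂ] (quasiSplit (↥(maximalRealSubfield L)) L (IsCMField.complexConj L) 2).L2 μ) (ω k) :=
  (resHAtom_le_resHBlock L μ U K' ω χ).trans (resHBlock_le_iInf_eigenspace L μ K' ω hHK' χ)

end Summit.HodgeConjecture.HodgeConjecture.R90.S8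

end
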